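import Mathlib
import HarnessLib
import Summits.HubbardSuperconductivity.HubbardSuperconductivity.Theorems.KLProgrammeKLRegimeSplitThermalLayer
import Summits.HubbardSuperconductivity.HubbardSuperconductivity.Theorems.KLProgrammeKLRegimeEngineV8DefsL4
import Summits.HubbardSuperconductivity.HubbardSuperconductivity.Theorems.KLProgrammeKLRegimeEngineV17F2ClosersVGQSharesCurrency

/-!
# K3 ENGINE (stmt-HubbardSuperconductivity-20437 `KLRegimeEngineV17F2`), row (c): the LENGTH OF THE EXTENDED LADDER against the temperature and the volume,
# and the ε-share of the (c)-OUT package for a WINDOW FAMILY on a `2⁻ⁿ` radius schedule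
# (cell gate-hubbard-kl, seat hubbard-kl-k3c2-p2 g28; technique «thermal-bar induction n ≤ nScales β + 1 with EngineBoundsAtV4S sums»)

WHY.  The window rows of the (c)-OUT package (ζ: `EngineV8.rowC_hexOut_of_pkgζ`; η: `…_of_pkgη`) charge each frequency window `w` of the dressed split by
`A₂ w · 4096·15381 · (ρw w/π + 1/L)` against the cubic slot `¼·Q.CR·(Klam|U|)³·2⁻ⁿ` (`hShareEps`).  ROWC-AT-KILL.md §4(ii) (evidence #43 on 20437) sizes the
model's data as `A₂ = O(Klam³U³)` UNIFORMLY in `n` with windows of radius `∝ 2⁻ⁿ`, and leaves one bracketed check: the `1/L` term needs `2ⁿ ≲ L` along the whole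
extended ladder `n ≤ n_β + 1`, `n_β = nScales β`.  This file proves it BY NAME from the thermal-layer dictionary (`4^{n_β} ≤ e₀β/π`, …KLRegimeSplitThermalLayer):
`4ⁿ ≤ β/(8π)` and `2ⁿ ≤ √(β/(8π)) ≤ β ≤ klEngL₃ β U ≤ klEngL₄ P R β U ≤ L` for every `n ≤ n_β + 1` — so `1/L ≤ 2⁻ⁿ` under the registered volume token, with no
condition on `U` — and then books the ε-share for a window FAMILY from n-UNIFORM cubic data on the schedule `ρw w ≤ 2¹⁰π·2⁻ⁿ`:
`Σ_w A₂ w ≤ 2¹⁸(Klam U)³`, `ε₁, εS ≤ 2³⁰(Klam U)³2⁻ⁿ` ⇒ `hShareEps` (family form of `rowC_shareEps_of_currency`, p718307).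
* §1 `klth_four_pow_nScales_le`, `klth_four_pow_le_of_le_nScales_succ`, `klth_two_pow_le_sqrt_of_le_nScales_succ`, `klth_two_pow_le_of_le_nScales_succ` (`2ⁿ ≤ β`);
* §2 `beta_le_klEngL₃`, `rowC_two_pow_le_of_klEngL₄_le` (`2ⁿ ≤ L`), `rowC_inv_le_inv_two_pow_of_klEngL₄_le` (`1/L ≤ 2⁻ⁿ`);
* §3 `rowC_shareEps_family_of_currency` (family form of the currency door), **`rowC_shareEps_family_of_schedule`**.
Pure real arithmetic on registered numerals; nothing here asserts any row of the package, (c), K3 or superconductivity.  0 kit · 0 lit.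
-/

noncomputable section

namespace Summit.HubbardSuperconductivity.HubbardSuperconductivity.Theorems.KLRegimeSplit

set_option linter.dupNamespace false -- summit = problem name (single-conjunct summit), D-0017

open Real Finset Literature.MathematicalPhysics.QuantumLattice Literature.Probability.LatticeModels
open Summit.HubbardSuperconductivity.HubbardSuperconductivity.Theorems.KLProgrammeLegKernels

/-! ## §1 The length of the extended ladder against the temperature -/

/-- `4^{n_β} ≤ e₀β/π` (`β ≥ klBetaMin`): the floor in `n_β = ⌊log₄(e₀β/π)⌋₊`, read off `π/β ≤ Λ_{n_β} = e₀4^{-n_β}`. -/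
theorem klth_four_pow_nScales_le {β : ℝ} (hβ : klBetaMin ≤ β) : (4 : ℝ) ^ (nScales β) ≤ klE0 * β / Real.pi := by
  have hβ0 : 0 < β := pos_of_klBetaMin_le hβ
  have h := klth_pi_div_le_klScale_nScales hβ
  have h4 : (0 : ℝ) < (4 : ℝ) ^ (nScales β) := by positivity
  unfold klScale at h
  rw [div_le_iff₀ hβ0] at h
  rw [le_div_iff₀ Real.pi_pos]
  have : Real.pi * (4 : ℝ) ^ nScales β ≤ klE0 * ((4 : ℝ) ^ nScales β)⁻¹ * β * (4 : ℝ) ^ nScales β :=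
    mul_le_mul_of_nonneg_right h h4.le
  calc (4 : ℝ) ^ nScales β * Real.pi = Real.pi * (4 : ℝ) ^ nScales β := by ring
    _ ≤ klE0 * ((4 : ℝ) ^ nScales β)⁻¹ * β * (4 : ℝ) ^ nScales β := this
    _ = klE0 * β := by field_simp

/-- **Along the whole extended ladder** `n ≤ n_β + 1`: `4ⁿ ≤ β/(8π)` (`= 4·e₀β/π`, `e₀ = 1/32`). -/
theorem klth_four_pow_le_of_le_nScales_succ {β : ℝ} (hβ : klBetaMin ≤ β) {n : ℕ} (hn : n ≤ nScales β + 1) :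
    (4 : ℝ) ^ n ≤ β / (8 * Real.pi) := by
  have h1 : (4 : ℝ) ^ n ≤ (4 : ℝ) ^ (nScales β + 1) := pow_le_pow_right₀ (by norm_num) hn
  have h2 := klth_four_pow_nScales_le hβ
  rw [pow_succ] at h1
  have h3 : (4 : ℝ) ^ nScales β * 4 ≤ klE0 * β / Real.pi * 4 := mul_le_mul_of_nonneg_right h2 (by norm_num)
  have h4 : klE0 * β / Real.pi * 4 = β / (8 * Real.pi) := by
    rw [klE0]; field_simp; ring
  linarith

/-- `2ⁿ ≤ √(β/(8π))` for `n ≤ n_β + 1`. -/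
theorem klth_two_pow_le_sqrt_of_le_nScales_succ {β : ℝ} (hβ : klBetaMin ≤ β) {n : ℕ} (hn : n ≤ nScales β + 1) :
    (2 : ℝ) ^ n ≤ Real.sqrt (β / (8 * Real.pi)) := by
  have h := klth_four_pow_le_of_le_nScales_succ hβ hn
  have h4 : (4 : ℝ) ^ n = ((2 : ℝ) ^ n) ^ 2 := by
    rw [← pow_mul, mul_comm, pow_mul]; norm_num
  rw [h4] at h
  exact Real.le_sqrt_of_sq_le h

/-- **`2ⁿ ≤ β`** for `n ≤ n_β + 1` and `β ≥ klBetaMin` (crude: `√(β/(8π)) ≤ β`). -/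
theorem klth_two_pow_le_of_le_nScales_succ {β : ℝ} (hβ : klBetaMin ≤ β) {n : ℕ} (hn : n ≤ nScales β + 1) : (2 : ℝ) ^ n ≤ β := by
  have h := klth_four_pow_le_of_le_nScales_succ hβ hn
  have hβ1 : (128 : ℝ) ≤ β := by simpa [klBetaMin] using hβ
  have h4 : (4 : ℝ) ^ n = ((2 : ℝ) ^ n) ^ 2 := by
    rw [← pow_mul, mul_comm, pow_mul]; norm_num
  rw [h4] at h
  have hπ : β / (8 * Real.pi) ≤ β ^ 2 := by
    rw [div_le_iff₀ (by positivity)]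
    nlinarith [Real.pi_gt_three]
  have h2 : 0 ≤ (2 : ℝ) ^ n := by positivity
  exact (pow_le_pow_iff_left₀ h2 (by linarith) (by norm_num : (2 : ℕ) ≠ 0)).mp (h.trans hπ)

/-- The number of Matsubara-index DOUBLINGS along the ladder is bounded by the temperature: `(2ⁿ)⁻¹ ≥ β⁻¹` for `n ≤ n_β + 1`. -/
theorem klth_inv_beta_le_inv_two_pow {β : ℝ} (hβ : klBetaMin ≤ β) {n : ℕ} (hn : n ≤ nScales β + 1) : β⁻¹ ≤ ((2 : ℝ) ^ n)⁻¹ :=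
  inv_anti₀ (by positivity) (klth_two_pow_le_of_le_nScales_succ hβ hn)

end Summit.HubbardSuperconductivity.HubbardSuperconductivity.Theorems.KLRegimeSplit

/-! ## §2 The length of the extended ladder against the registered volume token -/

namespace Summit.HubbardSuperconductivity.HubbardSuperconductivity.Theorems.EngineV8

set_option linter.dupNamespace false -- summit = problem name (single-conjunct summit), D-0017

open Real Finset Literature.MathematicalPhysics.QuantumLattice Literature.MathematicalPhysics.QuantumLattice.BandSectorCounting
open Summit.HubbardSuperconductivity.HubbardSuperconductivity.Theorems.KLProgrammeLegKernels
open Summit.HubbardSuperconductivity.HubbardSuperconductivity.Theorems.KLRegimeSplit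

/-- `β ≤ klEngL₃ β U` (`klEngL₃ β U = 2¹⁰(⌈|β|⌉₊ + 1)²(⌈|U|⁻¹⌉₊ + 1)²`; any real `β`). -/
theorem beta_le_klEngL₃ (β U : ℝ) : β ≤ (klEngL₃ β U : ℝ) := by
  unfold klEngL₃
  push_cast
  have h1 : β ≤ (⌈|β|⌉₊ : ℝ) + 1 := by
    have := Nat.le_ceil |β|
    have hb : β ≤ |β| := le_abs_self β
    linarith
  have h2 : (1 : ℝ) ≤ (⌈|β|⌉₊ : ℝ) + 1 := by
    have : (0 : ℝ) ≤ (⌈|β|⌉₊ : ℝ) := Nat.cast_nonneg _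
    linarith
  have h3 : (1 : ℝ) ≤ (⌈|U|⁻¹⌉₊ : ℝ) + 1 := by
    have : (0 : ℝ) ≤ (⌈|U|⁻¹⌉₊ : ℝ) := Nat.cast_nonneg _
    linarith
  have h4 : (⌈|β|⌉₊ : ℝ) + 1 ≤ ((⌈|β|⌉₊ : ℝ) + 1) ^ 2 := by nlinarith
  have h5 : (1 : ℝ) ≤ ((⌈|U|⁻¹⌉₊ : ℝ) + 1) ^ 2 := by nlinarith
  have h6 : ((⌈|β|⌉₊ : ℝ) + 1) ^ 2 ≤ 2 ^ 10 * ((⌈|β|⌉₊ : ℝ) + 1) ^ 2 * ((⌈|U|⁻¹⌉₊ : ℝ) + 1) ^ 2 := by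
    have h0 : 0 ≤ ((⌈|β|⌉₊ : ℝ) + 1) ^ 2 := by positivity
    nlinarith
  linarith

/-- **`2ⁿ ≤ L` along the extended ladder** under the registered volume token: `klEngL₄ P R β U ≤ L`, `β ≥ klBetaMin`, `n ≤ nScales β + 1` (no condition on `U`). -/
theorem rowC_two_pow_le_of_klEngL₄_le {P : SplitConsts} {R : RenConsts} {β U : ℝ} {L : ℕ} (hβ : klBetaMin ≤ β) (hL : klEngL₄ P R β U ≤ L)
    {n : ℕ} (hn : n ≤ nScales β + 1) : (2 : ℝ) ^ n ≤ (L : ℝ) := by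
  have h3 : klEngL₃ β U ≤ L := klEngL₃_le_of_klEngL₄_le hL
  have h3' : (klEngL₃ β U : ℝ) ≤ (L : ℝ) := by exact_mod_cast h3
  exact ((klth_two_pow_le_of_le_nScales_succ hβ hn).trans (beta_le_klEngL₃ β U)).trans h3'

/-- **`1/L ≤ 2⁻ⁿ` along the extended ladder** (same hypotheses) — the `1/L` term of the window rows decays like the cubic slot. -/
theorem rowC_inv_le_inv_two_pow_of_klEngL₄_le {P : SplitConsts} {R : RenConsts} {β U : ℝ} {L : ℕ} (hβ : klBetaMin ≤ β)
    (hL : klEngL₄ P R β U ≤ L) {n : ℕ} (hn : n ≤ nScales β + 1) : ((L : ℝ))⁻¹ ≤ ((2 : ℝ) ^ n)⁻¹ :=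
  inv_anti₀ (by positivity) (rowC_two_pow_le_of_klEngL₄_le hβ hL hn)

/-! ## §3 The ε-share of the (c)-OUT package for a window FAMILY -/

variable {P : SplitConsts} {R : RenConsts} {U : ℝ}

/-- **`hShareEps` (window FAMILY) FROM CURRENCY ROWS**: the cubic `2⁻ⁿ` forms `ε₁, εS ≤ 2³⁰(Klam U)³2⁻ⁿ` and the FAMILY currency
`Σ_w A₂ w·(ρw w/π + 1/L) ≤ 2²⁹(Klam U)³2⁻ⁿ` give the literal `hShareEps` row of packages ζ/η (`Q = klEngQ9dG klEngGeo14 P R`, `Q.CR ≥ 2⁶⁰`). -/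
theorem rowC_shareEps_family_of_currency (P : SplitConsts) (R : RenConsts) (hU : 0 < U) {L : ℕ} (n : ℕ) {Nw : ℕ} {ε₁ εS : ℝ} {A₂ ρw : Fin Nw → ℝ}
    (hε₁ : ε₁ ≤ 2 ^ 30 * (P.Klam * U) ^ 3 * ((2 : ℝ) ^ n)⁻¹) (hεS : εS ≤ 2 ^ 30 * (P.Klam * U) ^ 3 * ((2 : ℝ) ^ n)⁻¹)
    (hW : ∑ w, A₂ w * (ρw w / π + ((L : ℝ))⁻¹) ≤ 2 ^ 29 * (P.Klam * U) ^ 3 * ((2 : ℝ) ^ n)⁻¹) (hKU : 0 ≤ P.Klam * U) :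
    2 * (ε₁ * (2048 * 15367) + ∑ w, A₂ w * (4096 * 15381) * (ρw w / π + ((L : ℝ))⁻¹)) + 2 * (εS * (2048 * 15367)) ≤
      4⁻¹ * (klEngGeo11.cloc * (P.Klam * U) ^ 2 * (4 : ℝ) ^ (-(klEngGeo11.θ * n))) +
        4⁻¹ * ((klEngQ9dG klEngGeo14 P R).CR * (P.Klam * |U|) ^ 3 * ((2 : ℝ) ^ n)⁻¹) := by
  rw [abs_of_pos hU]
  have hP1 : 1 ≤ klEngPsq P := one_le_klEngPsq P
  have hR1 : 1 ≤ klEngRsq R := one_le_klEngRsq R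
  have hPR : 1 ≤ klEngPsq P ^ 2 * klEngRsq R ^ 2 := one_le_mul_of_one_le_of_one_le (one_le_pow₀ hP1) (one_le_pow₀ hR1)
  have hCR : 2 ^ 60 ≤ (klEngQ9dG klEngGeo14 P R).CR := by
    refine le_trans ?_ (rowC_hQCR klEngGeo14 P R)
    have : (2 : ℝ) ^ 60 ≤ 2 ^ 60 * (klEngPsq P ^ 2 * klEngRsq R ^ 2) := le_mul_of_one_le_right (by positivity) hPR
    exact this.trans_eq (by ring)
  have hslot : 0 ≤ klEngGeo11.cloc * (P.Klam * U) ^ 2 * (4 : ℝ) ^ (-(klEngGeo11.θ * n)) := by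
    have h4 : 0 < (4 : ℝ) ^ (-(klEngGeo11.θ * n)) := Real.rpow_pos_of_pos (by norm_num) _
    rw [klEngGeo11_cloc_eq]; positivity
  have hmain := shareEps_arith (a := 2048 * 15367) (b := 4096 * 15381) (pow_nonneg hKU 3) (by positivity : (0 : ℝ) ≤ ((2 : ℝ) ^ n)⁻¹)
    (by norm_num) (by norm_num) (by norm_num) (by norm_num) hε₁ hεS hW hCR hslot
  have e : (∑ w, A₂ w * (4096 * 15381) * (ρw w / π + ((L : ℝ))⁻¹)) = (∑ w, A₂ w * (ρw w / π + ((L : ℝ))⁻¹)) * (4096 * 15381) := by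
    rw [Finset.sum_mul]
    exact Finset.sum_congr rfl fun w _ => by ring
  rw [e]
  exact hmain

/-- **`hShareEps` (window FAMILY) ON THE `2⁻ⁿ` RADIUS SCHEDULE from n-UNIFORM cubic data**: `Σ_w A₂ w ≤ 2¹⁸(Klam U)³`, radii `ρw w ≤ 2¹⁰π·2⁻ⁿ`,
`ε₁, εS ≤ 2³⁰(Klam U)³2⁻ⁿ`, and the volume token `klEngL₄ P R β U ≤ L` on the extended ladder `n ≤ nScales β + 1` (`⇒ 1/L ≤ 2⁻ⁿ`, §2)
⇒ the literal `hShareEps` row of packages ζ/η.  (`2¹⁸·(2¹⁰ + 1) ≤ 2²⁹`.) -/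
theorem rowC_shareEps_family_of_schedule (P : SplitConsts) (R : RenConsts) {β : ℝ} (hβ : klBetaMin ≤ β) (hU : 0 < U) {L : ℕ}
    (hL : klEngL₄ P R β U ≤ L) {n : ℕ} (hn : n ≤ nScales β + 1) {Nw : ℕ} {ε₁ εS : ℝ} {A₂ ρw : Fin Nw → ℝ}
    (hε₁ : ε₁ ≤ 2 ^ 30 * (P.Klam * U) ^ 3 * ((2 : ℝ) ^ n)⁻¹) (hεS : εS ≤ 2 ^ 30 * (P.Klam * U) ^ 3 * ((2 : ℝ) ^ n)⁻¹)
    (hA2 : ∀ w, 0 ≤ A₂ w) (hρ : ∀ w, ρw w ≤ 2 ^ 10 * Real.pi * ((2 : ℝ) ^ n)⁻¹)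
    (hA : ∑ w, A₂ w ≤ 2 ^ 18 * (P.Klam * U) ^ 3) (hKU : 0 ≤ P.Klam * U) :
    2 * (ε₁ * (2048 * 15367) + ∑ w, A₂ w * (4096 * 15381) * (ρw w / π + ((L : ℝ))⁻¹)) + 2 * (εS * (2048 * 15367)) ≤
      4⁻¹ * (klEngGeo11.cloc * (P.Klam * U) ^ 2 * (4 : ℝ) ^ (-(klEngGeo11.θ * n))) +
        4⁻¹ * ((klEngQ9dG klEngGeo14 P R).CR * (P.Klam * |U|) ^ 3 * ((2 : ℝ) ^ n)⁻¹) := by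
  refine rowC_shareEps_family_of_currency P R hU n hε₁ hεS ?_ hKU
  have hLn := rowC_inv_le_inv_two_pow_of_klEngL₄_le hβ hL hn
  have hD : 0 ≤ ((2 : ℝ) ^ n)⁻¹ := by positivity
  -- each window: `ρw w/π + 1/L ≤ (2¹⁰ + 1)·2⁻ⁿ`
  have hw : ∀ w, A₂ w * (ρw w / π + ((L : ℝ))⁻¹) ≤ A₂ w * ((2 ^ 10 + 1) * ((2 : ℝ) ^ n)⁻¹) := by
    intro w
    refine mul_le_mul_of_nonneg_left ?_ (hA2 w)
    have h1 : ρw w / π ≤ 2 ^ 10 * ((2 : ℝ) ^ n)⁻¹ := by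
      rw [div_le_iff₀ Real.pi_pos]
      calc ρw w ≤ 2 ^ 10 * Real.pi * ((2 : ℝ) ^ n)⁻¹ := hρ w
        _ = 2 ^ 10 * ((2 : ℝ) ^ n)⁻¹ * π := by ring
    linarith
  have hsum : ∑ w, A₂ w * (ρw w / π + ((L : ℝ))⁻¹) ≤ ∑ w, A₂ w * ((2 ^ 10 + 1) * ((2 : ℝ) ^ n)⁻¹) := Finset.sum_le_sum fun w _ => hw w
  rw [← Finset.sum_mul] at hsum
  have hK3 : 0 ≤ (P.Klam * U) ^ 3 := pow_nonneg hKU 3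
  calc ∑ w, A₂ w * (ρw w / π + ((L : ℝ))⁻¹) ≤ (∑ w, A₂ w) * ((2 ^ 10 + 1) * ((2 : ℝ) ^ n)⁻¹) := hsum
    _ ≤ 2 ^ 18 * (P.Klam * U) ^ 3 * ((2 ^ 10 + 1) * ((2 : ℝ) ^ n)⁻¹) := mul_le_mul_of_nonneg_right hA (by positivity)
    _ ≤ 2 ^ 29 * (P.Klam * U) ^ 3 * ((2 : ℝ) ^ n)⁻¹ := by nlinarith

/-! ## §4 (appended, seat k3c2-p2 g29) The joint ε-envelope `hShareEpsL` of package θ with the localisation row `RL` in pp-moduli form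

Package θ (`rowC_hexOut_of_pkgθ`, …EngineV17F2ClosersVGQOutT; cure (δ′) of located #17) books the frequency-localisation remainder `RL` TOGETHER with the
ε-charges: `hShareEpsL : 2(ε₁·C + Σ_w A₂ w·C′·(ρw w/π + 1/L)) + 2εS·C + RL ≤ ¼(α) + ¼(β)`.  The producer-side bricks …EnginePairTransferPPRateSupport /
…PPRateWindow (`klpr_hLr_of_ppModuli`) deliver row `hLr` with `RL := 2¹⁰·15367·ε_L + Σ_w 2¹⁰·15381·(ρL w/π + 1/L)·A_L w` from an OFF-window modulus `ε_L` and
ON-window moduli `A_L w` of the pp bracket (its own window family `(ρL, A_L)`).  This section books THAT `RL` from the same n-uniform cubic data as the (ε)(W)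
rows: `ε_L ≤ 2³⁰(Klam U)³2⁻ⁿ`, `Σ_w A_L w ≤ 2¹⁸(Klam U)³`, `ρL w ≤ 2¹⁰π·2⁻ⁿ` — ROOM: `3·2⁵⁶ + (3/2)·2⁵⁴ = (27/2)·2⁵⁴ ≤ 2⁵⁸ = ¼·2⁶⁰` (×1.19 left). -/

/-- Generic core of `hShareEpsL`: `2(ε₁a + Wb) + 2εS·a + (ε_L·a′ + W_L·b′) ≤ ¼·slot + ¼·CR·K3·D` for `a ≤ 2²⁵`, `b ≤ 2²⁶`, `a′, b′ ≤ 2²⁴`,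
`ε₁, εS, ε_L ≤ 2³⁰K3D`, `W, W_L ≤ 2²⁹K3D`, `CR ≥ 2⁶⁰`, `slot ≥ 0`. -/
theorem shareEpsL_arith {ε₁ εS W εL WL a b a' b' K3 D CR slot : ℝ} (hK3 : 0 ≤ K3) (hD : 0 ≤ D) (ha0 : 0 ≤ a) (ha : a ≤ 2 ^ 25) (hb0 : 0 ≤ b)
    (hb : b ≤ 2 ^ 26) (ha0' : 0 ≤ a') (ha' : a' ≤ 2 ^ 24) (hb0' : 0 ≤ b') (hb' : b' ≤ 2 ^ 24)
    (hε₁ : ε₁ ≤ 2 ^ 30 * K3 * D) (hεS : εS ≤ 2 ^ 30 * K3 * D) (hW : W ≤ 2 ^ 29 * K3 * D) (hεL : εL ≤ 2 ^ 30 * K3 * D) (hWL : WL ≤ 2 ^ 29 * K3 * D)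
    (hCR : 2 ^ 60 ≤ CR) (hslot : 0 ≤ slot) :
    2 * (ε₁ * a + W * b) + 2 * (εS * a) + (εL * a' + WL * b') ≤ 4⁻¹ * slot + 4⁻¹ * (CR * K3 * D) := by
  have hKD : 0 ≤ K3 * D := mul_nonneg hK3 hD
  have h1 : ε₁ * a ≤ 2 ^ 30 * K3 * D * 2 ^ 25 := by nlinarith
  have h2 : εS * a ≤ 2 ^ 30 * K3 * D * 2 ^ 25 := by nlinarith
  have h3 : W * b ≤ 2 ^ 29 * K3 * D * 2 ^ 26 := by nlinarith
  have h5 : εL * a' ≤ 2 ^ 30 * K3 * D * 2 ^ 24 := by nlinarith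
  have h6 : WL * b' ≤ 2 ^ 29 * K3 * D * 2 ^ 24 := by nlinarith
  have h4 : 2 ^ 60 * (K3 * D) ≤ CR * (K3 * D) := mul_le_mul_of_nonneg_right hCR hKD
  nlinarith

/-- **`hShareEpsL` (package θ) FROM CURRENCY ROWS**: `ε₁, εS, ε_L ≤ 2³⁰(Klam U)³2⁻ⁿ`, `Σ_w A₂ w·(ρw w/π + 1/L) ≤ 2²⁹(Klam U)³2⁻ⁿ`,
`Σ_w A_L w·(ρL w/π + 1/L) ≤ 2²⁹(Klam U)³2⁻ⁿ` ⇒ θ's literal `hShareEpsL` with `RL := 2¹⁰·15367·ε_L + Σ_w 2¹⁰·15381·(ρL w/π + 1/L)·A_L w`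
(`Q = klEngQ9dG klEngGeo14 P R`, `Q.CR ≥ 2⁶⁰`). -/
theorem rowC_shareEpsL_family_of_currency (P : SplitConsts) (R : RenConsts) (hU : 0 < U) {L : ℕ} (n : ℕ) {Nw NL : ℕ} {ε₁ εS εL : ℝ}
    {A₂ ρw : Fin Nw → ℝ} {AL ρL : Fin NL → ℝ}
    (hε₁ : ε₁ ≤ 2 ^ 30 * (P.Klam * U) ^ 3 * ((2 : ℝ) ^ n)⁻¹) (hεS : εS ≤ 2 ^ 30 * (P.Klam * U) ^ 3 * ((2 : ℝ) ^ n)⁻¹)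
    (hεL : εL ≤ 2 ^ 30 * (P.Klam * U) ^ 3 * ((2 : ℝ) ^ n)⁻¹)
    (hW : ∑ w, A₂ w * (ρw w / π + ((L : ℝ))⁻¹) ≤ 2 ^ 29 * (P.Klam * U) ^ 3 * ((2 : ℝ) ^ n)⁻¹)
    (hWL : ∑ w, AL w * (ρL w / π + ((L : ℝ))⁻¹) ≤ 2 ^ 29 * (P.Klam * U) ^ 3 * ((2 : ℝ) ^ n)⁻¹) (hKU : 0 ≤ P.Klam * U) :
    2 * (ε₁ * (2048 * 15367) + ∑ w, A₂ w * (4096 * 15381) * (ρw w / π + ((L : ℝ))⁻¹)) + 2 * (εS * (2048 * 15367)) +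
        ((2 : ℝ) ^ 10 * 15367 * εL + ∑ w, (2 : ℝ) ^ 10 * 15381 * (ρL w / π + ((L : ℝ))⁻¹) * AL w) ≤
      4⁻¹ * (klEngGeo11.cloc * (P.Klam * U) ^ 2 * (4 : ℝ) ^ (-(klEngGeo11.θ * n))) +
        4⁻¹ * ((klEngQ9dG klEngGeo14 P R).CR * (P.Klam * |U|) ^ 3 * ((2 : ℝ) ^ n)⁻¹) := by
  rw [abs_of_pos hU]
  have hP1 : 1 ≤ klEngPsq P := one_le_klEngPsq P
  have hR1 : 1 ≤ klEngRsq R := one_le_klEngRsq R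
  have hPR : 1 ≤ klEngPsq P ^ 2 * klEngRsq R ^ 2 := one_le_mul_of_one_le_of_one_le (one_le_pow₀ hP1) (one_le_pow₀ hR1)
  have hCR : 2 ^ 60 ≤ (klEngQ9dG klEngGeo14 P R).CR := by
    refine le_trans ?_ (rowC_hQCR klEngGeo14 P R)
    have : (2 : ℝ) ^ 60 ≤ 2 ^ 60 * (klEngPsq P ^ 2 * klEngRsq R ^ 2) := le_mul_of_one_le_right (by positivity) hPR
    exact this.trans_eq (by ring)
  have hslot : 0 ≤ klEngGeo11.cloc * (P.Klam * U) ^ 2 * (4 : ℝ) ^ (-(klEngGeo11.θ * n)) := by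
    have h4 : 0 < (4 : ℝ) ^ (-(klEngGeo11.θ * n)) := Real.rpow_pos_of_pos (by norm_num) _
    rw [klEngGeo11_cloc_eq]; positivity
  have hmain := shareEpsL_arith (a := 2048 * 15367) (b := 4096 * 15381) (a' := (2 : ℝ) ^ 10 * 15367) (b' := (2 : ℝ) ^ 10 * 15381)
    (pow_nonneg hKU 3) (by positivity : (0 : ℝ) ≤ ((2 : ℝ) ^ n)⁻¹)
    (by norm_num) (by norm_num) (by norm_num) (by norm_num) (by norm_num) (by norm_num) (by norm_num) (by norm_num) hε₁ hεS hW hεL hWL hCR hslot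
  have e : (∑ w, A₂ w * (4096 * 15381) * (ρw w / π + ((L : ℝ))⁻¹)) = (∑ w, A₂ w * (ρw w / π + ((L : ℝ))⁻¹)) * (4096 * 15381) := by
    rw [Finset.sum_mul]
    exact Finset.sum_congr rfl fun w _ => by ring
  have e' : (∑ w, (2 : ℝ) ^ 10 * 15381 * (ρL w / π + ((L : ℝ))⁻¹) * AL w) = (∑ w, AL w * (ρL w / π + ((L : ℝ))⁻¹)) * ((2 : ℝ) ^ 10 * 15381) := by
    rw [Finset.sum_mul]
    exact Finset.sum_congr rfl fun w _ => by ring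
  rw [e, e', show (2 : ℝ) ^ 10 * 15367 * εL = εL * ((2 : ℝ) ^ 10 * 15367) by ring]
  exact hmain

/-- A window family on the `2⁻ⁿ` radius schedule with n-uniform cubic total: `Σ_w A w ≤ 2¹⁸(Klam U)³`, `ρ w ≤ 2¹⁰π·2⁻ⁿ`, `1/L ≤ 2⁻ⁿ` ⇒
`Σ_w A w·(ρ w/π + 1/L) ≤ 2²⁹(Klam U)³2⁻ⁿ` (the step shared by `rowC_shareEps_family_of_schedule` and its θ twin). -/
theorem rowC_window_family_currency_of_schedule (P : SplitConsts) {U : ℝ} {L : ℕ} {n : ℕ} (hLn : ((L : ℝ))⁻¹ ≤ ((2 : ℝ) ^ n)⁻¹)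
    {Nw : ℕ} {A ρ : Fin Nw → ℝ} (hA0 : ∀ w, 0 ≤ A w) (hρ : ∀ w, ρ w ≤ 2 ^ 10 * Real.pi * ((2 : ℝ) ^ n)⁻¹)
    (hA : ∑ w, A w ≤ 2 ^ 18 * (P.Klam * U) ^ 3) (hKU : 0 ≤ P.Klam * U) :
    ∑ w, A w * (ρ w / π + ((L : ℝ))⁻¹) ≤ 2 ^ 29 * (P.Klam * U) ^ 3 * ((2 : ℝ) ^ n)⁻¹ := by
  have hD : 0 ≤ ((2 : ℝ) ^ n)⁻¹ := by positivity
  have hw : ∀ w, A w * (ρ w / π + ((L : ℝ))⁻¹) ≤ A w * ((2 ^ 10 + 1) * ((2 : ℝ) ^ n)⁻¹) := by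
    intro w
    refine mul_le_mul_of_nonneg_left ?_ (hA0 w)
    have h1 : ρ w / π ≤ 2 ^ 10 * ((2 : ℝ) ^ n)⁻¹ := by
      rw [div_le_iff₀ Real.pi_pos]
      calc ρ w ≤ 2 ^ 10 * Real.pi * ((2 : ℝ) ^ n)⁻¹ := hρ w
        _ = 2 ^ 10 * ((2 : ℝ) ^ n)⁻¹ * π := by ring
    linarith
  have hsum : ∑ w, A w * (ρ w / π + ((L : ℝ))⁻¹) ≤ ∑ w, A w * ((2 ^ 10 + 1) * ((2 : ℝ) ^ n)⁻¹) := Finset.sum_le_sum fun w _ => hw w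
  rw [← Finset.sum_mul] at hsum
  have hK3 : 0 ≤ (P.Klam * U) ^ 3 := pow_nonneg hKU 3
  calc ∑ w, A w * (ρ w / π + ((L : ℝ))⁻¹) ≤ (∑ w, A w) * ((2 ^ 10 + 1) * ((2 : ℝ) ^ n)⁻¹) := hsum
    _ ≤ 2 ^ 18 * (P.Klam * U) ^ 3 * ((2 ^ 10 + 1) * ((2 : ℝ) ^ n)⁻¹) := mul_le_mul_of_nonneg_right hA (by positivity)
    _ ≤ 2 ^ 29 * (P.Klam * U) ^ 3 * ((2 : ℝ) ^ n)⁻¹ := by nlinarith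

/-- **`hShareEpsL` (package θ) ON THE `2⁻ⁿ` RADIUS SCHEDULE from n-UNIFORM cubic data**: both window families (the dressed split's `(A₂, ρw)` and the pp
bracket's `(A_L, ρL)`) with `Σ ≤ 2¹⁸(Klam U)³` and radii `≤ 2¹⁰π·2⁻ⁿ`, `ε₁, εS, ε_L ≤ 2³⁰(Klam U)³2⁻ⁿ`, and the volume token `klEngL₄ P R β U ≤ L` on the extended ladder
`n ≤ nScales β + 1` (`⇒ 1/L ≤ 2⁻ⁿ`, §2) ⇒ θ's literal `hShareEpsL` with `RL := 2¹⁰·15367·ε_L + Σ_w 2¹⁰·15381·(ρL w/π + 1/L)·A_L w` (the `RL` of `klpr_hLr_of_ppModuli`). -/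
theorem rowC_shareEpsL_family_of_schedule (P : SplitConsts) (R : RenConsts) {β : ℝ} (hβ : klBetaMin ≤ β) (hU : 0 < U) {L : ℕ}
    (hL : klEngL₄ P R β U ≤ L) {n : ℕ} (hn : n ≤ nScales β + 1) {Nw NL : ℕ} {ε₁ εS εL : ℝ} {A₂ ρw : Fin Nw → ℝ} {AL ρL : Fin NL → ℝ}
    (hε₁ : ε₁ ≤ 2 ^ 30 * (P.Klam * U) ^ 3 * ((2 : ℝ) ^ n)⁻¹) (hεS : εS ≤ 2 ^ 30 * (P.Klam * U) ^ 3 * ((2 : ℝ) ^ n)⁻¹)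
    (hεL : εL ≤ 2 ^ 30 * (P.Klam * U) ^ 3 * ((2 : ℝ) ^ n)⁻¹)
    (hA2 : ∀ w, 0 ≤ A₂ w) (hρ : ∀ w, ρw w ≤ 2 ^ 10 * Real.pi * ((2 : ℝ) ^ n)⁻¹) (hA : ∑ w, A₂ w ≤ 2 ^ 18 * (P.Klam * U) ^ 3)
    (hAL : ∀ w, 0 ≤ AL w) (hρL : ∀ w, ρL w ≤ 2 ^ 10 * Real.pi * ((2 : ℝ) ^ n)⁻¹) (hALs : ∑ w, AL w ≤ 2 ^ 18 * (P.Klam * U) ^ 3)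
    (hKU : 0 ≤ P.Klam * U) :
    2 * (ε₁ * (2048 * 15367) + ∑ w, A₂ w * (4096 * 15381) * (ρw w / π + ((L : ℝ))⁻¹)) + 2 * (εS * (2048 * 15367)) +
        ((2 : ℝ) ^ 10 * 15367 * εL + ∑ w, (2 : ℝ) ^ 10 * 15381 * (ρL w / π + ((L : ℝ))⁻¹) * AL w) ≤
      4⁻¹ * (klEngGeo11.cloc * (P.Klam * U) ^ 2 * (4 : ℝ) ^ (-(klEngGeo11.θ * n))) +
        4⁻¹ * ((klEngQ9dG klEngGeo14 P R).CR * (P.Klam * |U|) ^ 3 * ((2 : ℝ) ^ n)⁻¹) := by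
  have hLn := rowC_inv_le_inv_two_pow_of_klEngL₄_le hβ hL hn
  exact rowC_shareEpsL_family_of_currency P R hU n hε₁ hεS hεL (rowC_window_family_currency_of_schedule P hLn hA2 hρ hA hKU)
    (rowC_window_family_currency_of_schedule P hLn hAL hρL hALs hKU) hKU

end Summit.HubbardSuperconductivity.HubbardSuperconductivity.Theorems.EngineV8

end
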